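/-
Origin: expansion seat `planner-pub-hodgecm-pv10-0`, handover #4 2026-08-18T04:04:57Z / 04:06:34Z (`HOME/pub-hodgecm-pv10/lean/Pv10/InfinityType.lean`, md5 2a8c3bca, 241 lines);
landed by the gen-5 packager in gate run 21 as `HodgeCM/PerL34/InfinityType.lean` (import ^import Pv[0-9]+\.→import HodgeCM.PerL34. ×1).
-/
/-
Origin: planner-pub-hodgecm-pv10-0 (unit pub-hodgecm-pv10), HodgeCM publication cell, 2026-08-18.
Vocabulary D3 (LEMMAS.md §3): unitary ∞-types of Hecke characters over Mathlib's adeles, and node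
N15 (PerL v5 §3.2, tex ll. 304–314) "unitary Hecke characters of PRESCRIBED ∞-type" over `C_K`.
At landing `Pv10.HeckeCharExtensionCont` → `HodgeCM.PerL34.HeckeCharExtensionCont`.
-/
import Summits.HodgeConjecture.HodgeCM.PerL34.HeckeCharExtensionCont
import Mathlib.NumberTheory.NumberField.InfiniteAdeleRing
import Mathlib.Analysis.Complex.Circle

/-!
# Unitary ∞-types of Hecke characters (vocabulary D3) and N15 with prescribed ∞-type

* `Complex.unitPart : ℂˣ →* Circle`, `z ↦ z / ‖z‖` (continuous);
* `NumberField.InfiniteAdeleRing.infLocalUnits K v : (K_∞)ˣ →* ℂˣ` — the `v`-component followed by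
  the canonical embedding `K_v →+* ℂ` (`extensionEmbedding`; for a real place its image is real, so
  `unitPart` of it is `±1`);
* `NumberField.infinityTypeChar K e : (K_∞)ˣ →* Circle`, `u ↦ ∏_v (u_v/‖u_v‖)^{e_v}` for integers
  `e : InfinitePlace K → ℤ` — the unitary character of ∞-type `e` (continuous);
* `NumberField.UnitaryHeckeCharacter.HasInfinityType ψ e` — `ψ ∘ [K_∞^× → C_K] = infinityTypeChar e`;
* `NumberField.exists_unitaryHeckeCharacter_of_infinityType` — **N15 with prescribed ∞-type**: if
  `B ≤ C_K` contains the image of `K_∞^×` and `χ : B →* S¹` is continuous with `χ|_{K_∞^×}` of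
  ∞-type `e`, then `χ` extends to a unitary Hecke character of ∞-type `e`.

Everything is KERNEL over Mathlib; no print input.
-/

set_option autoImplicit false

noncomputable section

open Topology

/-! ## The angular part `z ↦ z/‖z‖` -/

namespace Complex

/-- The angular part `z ↦ z / ‖z‖ : ℂˣ → S¹`. -/
def unitPart : ℂˣ →* Circle where
  toFun z := ⟨(z : ℂ) / ‖(z : ℂ)‖, mem_sphere_zero_iff_norm.2 <| by
    rw [norm_div, Complex.norm_real, norm_norm, div_self (norm_ne_zero_iff.mpr z.ne_zero)]⟩
  map_one' := Subtype.ext <| by simp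
  map_mul' x y := Subtype.ext <| by
    simp only [Units.val_mul, norm_mul, Complex.ofReal_mul]
    show (x : ℂ) * y / (‖(x : ℂ)‖ * ‖(y : ℂ)‖ : ℂ) = (x : ℂ) / ‖(x : ℂ)‖ * ((y : ℂ) / ‖(y : ℂ)‖)
    rw [div_mul_div_comm]

/-- (Ported verbatim from the HodgeCMPerL package; no docstring in the source.) -/
@[simp] theorem coe_unitPart (z : ℂˣ) : (unitPart z : ℂ) = (z : ℂ) / ‖(z : ℂ)‖ := rfl

/-- (Ported verbatim from the HodgeCMPerL package; no docstring in the source.) -/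
theorem continuous_unitPart : Continuous unitPart := by
  have h : Continuous fun z : ℂˣ => (z : ℂ) / (‖(z : ℂ)‖ : ℂ) :=
    Units.continuous_val.div (Complex.continuous_ofReal.comp (continuous_norm.comp
      Units.continuous_val)) fun z => by exact_mod_cast norm_ne_zero_iff.mpr z.ne_zero
  exact Continuous.subtype_mk h _

/-- On the norm-one elements the angular part is the identity. -/
theorem unitPart_apply_of_norm_eq_one (z : ℂˣ) (hz : ‖(z : ℂ)‖ = 1) :
    (unitPart z : ℂ) = z := by
  simp [hz]

end Complex

/-! ## ∞-components and unitary ∞-types -/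

namespace NumberField

open InfinitePlace InfinitePlace.Completion

variable (K : Type*) [Field K]

namespace InfiniteAdeleRing

/-- Evaluation of an infinite adele at the infinite place `v`. -/
def evalRingHom (v : InfinitePlace K) : InfiniteAdeleRing K →+* v.Completion :=
  Pi.evalRingHom (fun w : InfinitePlace K => w.Completion) v

/-- (Ported verbatim from the HodgeCMPerL package; no docstring in the source.) -/
@[simp] theorem evalRingHom_apply (v : InfinitePlace K) (x : InfiniteAdeleRing K) :
    evalRingHom K v x = x v := rfl

/-- (Ported verbatim from the HodgeCMPerL package; no docstring in the source.) -/
theorem continuous_evalRingHom (v : InfinitePlace K) : Continuous (evalRingHom K v) :=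
  continuous_apply v

/-- The `v`-component of an infinite idele, read in `ℂ` through the canonical embedding
`K_v →+* ℂ`: `(K_∞)ˣ →* ℂˣ`. -/
def infLocalUnits (v : InfinitePlace K) : (InfiniteAdeleRing K)ˣ →* ℂˣ :=
  (Units.map (extensionEmbedding v).toMonoidHom).comp (Units.map (evalRingHom K v).toMonoidHom)

/-- (Ported verbatim from the HodgeCMPerL package; no docstring in the source.) -/
@[simp] theorem coe_infLocalUnits (v : InfinitePlace K) (u : (InfiniteAdeleRing K)ˣ) :
    (infLocalUnits K v u : ℂ) = extensionEmbedding v ((u : InfiniteAdeleRing K) v) := rfl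

/-- (Ported verbatim from the HodgeCMPerL package; no docstring in the source.) -/
theorem continuous_infLocalUnits (v : InfinitePlace K) : Continuous (infLocalUnits K v) :=
  (Continuous.units_map _ (isometry_extensionEmbedding v).continuous).comp
    (Continuous.units_map _ (continuous_evalRingHom K v))

/-- At a real place the `ℂ`-valued component is real. -/
theorem infLocalUnits_mem_real {v : InfinitePlace K} (hv : v.IsReal) (u : (InfiniteAdeleRing K)ˣ) :
    ∃ r : ℝ, (infLocalUnits K v u : ℂ) = r :=
  ⟨extensionEmbeddingOfIsReal hv ((u : InfiniteAdeleRing K) v), by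
    rw [coe_infLocalUnits, extensionEmbeddingOfIsReal_apply]⟩

end InfiniteAdeleRing

open InfiniteAdeleRing

variable [NumberField K]

/-- The unitary character of `(K_∞)ˣ` of ∞-type `e`: `u ↦ ∏_v (u_v/‖u_v‖)^{e_v}`. -/
def infinityTypeChar (e : InfinitePlace K → ℤ) : (InfiniteAdeleRing K)ˣ →* Circle where
  toFun u := ∏ v : InfinitePlace K, Complex.unitPart (infLocalUnits K v u) ^ e v
  map_one' := by simp
  map_mul' x y := by
    simp only [map_mul, mul_zpow, Finset.prod_mul_distrib]

/-- (Ported verbatim from the HodgeCMPerL package; no docstring in the source.) -/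
theorem infinityTypeChar_apply (e : InfinitePlace K → ℤ) (u : (InfiniteAdeleRing K)ˣ) :
    infinityTypeChar K e u = ∏ v : InfinitePlace K, Complex.unitPart (infLocalUnits K v u) ^ e v :=
  rfl

/-- (Ported verbatim from the HodgeCMPerL package; no docstring in the source.) -/
theorem continuous_infinityTypeChar (e : InfinitePlace K → ℤ) :
    Continuous (infinityTypeChar K e) := by
  show Continuous fun u => ∏ v : InfinitePlace K, Complex.unitPart (infLocalUnits K v u) ^ e v
  refine continuous_finsetProd _ fun v _ => ?_
  exact (Complex.continuous_unitPart.comp (continuous_infLocalUnits K v)).zpow (e v)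

/-- A unitary Hecke character `ψ` has (unitary) ∞-type `e` when its restriction to `K_∞^×` is
`u ↦ ∏_v (u_v/‖u_v‖)^{e_v}`. -/
def UnitaryHeckeCharacter.HasInfinityType (ψ : UnitaryHeckeCharacter K)
    (e : InfinitePlace K → ℤ) : Prop :=
  ∀ u : (InfiniteAdeleRing K)ˣ, ψ (infUnitsToClass K u) = infinityTypeChar K e u

/-- **N15 with prescribed ∞-type** (PerL v5 §3.2, ll. 304–314, for `GL₁` over Mathlib's adeles).
Let `B ≤ C_K` contain the image of `K_∞^×` and let `χ : B →* S¹` be continuous whose restriction to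
`K_∞^×` is the ∞-type character `e`.  Then `χ` is the restriction of a unitary Hecke character of
∞-type `e`. -/
theorem exists_unitaryHeckeCharacter_of_infinityType (B : Subgroup (IdeleClassGroup K))
    (hNB : ∀ x : (InfiniteAdeleRing K)ˣ, infUnitsToClass K x ∈ B) (χ : B →* Circle)
    (hχ : Continuous χ) (e : InfinitePlace K → ℤ)
    (hχe : ∀ u : (InfiniteAdeleRing K)ˣ, χ ⟨infUnitsToClass K u, hNB u⟩ = infinityTypeChar K e u) :
    ∃ ψ : UnitaryHeckeCharacter K,
      ψ.HasInfinityType K e ∧ ∀ b : B, ψ (b : IdeleClassGroup K) = χ b := by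
  obtain ⟨ψ, hψ⟩ := exists_unitaryHeckeCharacter_extension_of_continuous K B hNB χ hχ
  refine ⟨ψ, fun u => ?_, hψ⟩
  rw [← hχe u]
  exact hψ ⟨infUnitsToClass K u, hNB u⟩

/-- `HasInfinityType` as an identity of homomorphisms `(K_∞)ˣ →* S¹`. -/
theorem UnitaryHeckeCharacter.hasInfinityType_iff (ψ : UnitaryHeckeCharacter K)
    (e : InfinitePlace K → ℤ) :
    ψ.HasInfinityType K e ↔
      ψ.toMonoidHom.comp (infUnitsToClass K) = infinityTypeChar K e := by
  constructor
  · intro h; ext u; exact congrArg Subtype.val (h u)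
  · intro h u
    have := congrArg (fun f : (InfiniteAdeleRing K)ˣ →* Circle => f u) h
    simpa using this

/-! ## The ∞-type at complex places is determined by the character -/

namespace InfiniteAdeleRing

omit [NumberField K] in
open scoped Classical in
/-- The infinite idele which is `c` at `v` and `1` elsewhere. -/
def singleUnits (v : InfinitePlace K) : (v.Completion)ˣ →* (InfiniteAdeleRing K)ˣ :=
  Units.map (MonoidHom.mulSingle (fun w : InfinitePlace K => w.Completion) v)

omit [NumberField K] in
open scoped Classical in
/-- (Ported verbatim from the HodgeCMPerL package; no docstring in the source.) -/
theorem singleUnits_apply_self (v : InfinitePlace K) (c : (v.Completion)ˣ) :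
    ((singleUnits K v c : (InfiniteAdeleRing K)ˣ) : InfiniteAdeleRing K) v = c := by
  show (Pi.mulSingle (M := fun w : InfinitePlace K => w.Completion) v (c : v.Completion)) v = c
  exact Pi.mulSingle_eq_same v _

omit [NumberField K] in
open scoped Classical in
/-- (Ported verbatim from the HodgeCMPerL package; no docstring in the source.) -/
theorem singleUnits_apply_of_ne (v : InfinitePlace K) (c : (v.Completion)ˣ) {w : InfinitePlace K}
    (hw : w ≠ v) : ((singleUnits K v c : (InfiniteAdeleRing K)ˣ) : InfiniteAdeleRing K) w = 1 := by
  show (Pi.mulSingle (M := fun w : InfinitePlace K => w.Completion) v (c : v.Completion)) w = 1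
  exact Pi.mulSingle_eq_of_ne hw _

end InfiniteAdeleRing

/-- The value of the ∞-type character on an idele concentrated at one place. -/
theorem infinityTypeChar_singleUnits (e : InfinitePlace K → ℤ) (v : InfinitePlace K)
    (c : (v.Completion)ˣ) :
    infinityTypeChar K e (singleUnits K v c) =
      Complex.unitPart (Units.map (extensionEmbedding v).toMonoidHom c) ^ e v := by
  rw [infinityTypeChar_apply, Finset.prod_eq_single v]
  · congr 2
    ext
    simp [singleUnits_apply_self]
  · intro w _ hw
    have : infLocalUnits K w (singleUnits K v c) = 1 := by
      ext
      simp [singleUnits_apply_of_ne K v c hw]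
    rw [this, map_one, one_zpow]
  · intro h; exact absurd (Finset.mem_univ v) h

/-- A unit complex number `ζ` with `ζ ^ d ≠ 1`, for `d ≠ 0`: `ζ = exp(π i / d)`. -/
theorem _root_.Complex.exists_norm_eq_one_zpow_ne_one {d : ℤ} (hd : d ≠ 0) :
    ∃ ζ : ℂ, ‖ζ‖ = 1 ∧ ζ ^ d ≠ 1 := by
  refine ⟨Complex.exp ((Real.pi / d : ℝ) * Complex.I), Complex.norm_exp_ofReal_mul_I _, ?_⟩
  rw [← Complex.exp_int_mul]
  have : (d : ℂ) * (((Real.pi / d : ℝ) : ℂ) * Complex.I) = Real.pi * Complex.I := by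
    have hd' : (d : ℂ) ≠ 0 := by exact_mod_cast hd
    push_cast
    field_simp
  rw [this, Complex.exp_pi_mul_I]
  norm_num

/-- **The ∞-type at a complex place is determined by the ∞-type character.** -/
theorem infinityTypeChar_injective_of_isComplex {e e' : InfinitePlace K → ℤ}
    (h : infinityTypeChar K e = infinityTypeChar K e') {v : InfinitePlace K} (hv : v.IsComplex) :
    e v = e' v := by
  by_contra hne
  have hd : e v - e' v ≠ 0 := sub_ne_zero.mpr hne
  obtain ⟨ζ, hζ1, hζd⟩ := Complex.exists_norm_eq_one_zpow_ne_one hd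
  have hζ0 : ζ ≠ 0 := fun h0 => by simp [h0] at hζ1
  obtain ⟨c, hc⟩ := surjective_extensionEmbedding_of_isComplex hv ζ
  have hc0 : c ≠ 0 := fun h0 => hζ0 (by rw [← hc, h0, map_zero])
  let cu : (v.Completion)ˣ := Units.mk0 c hc0
  have hval : (Complex.unitPart (Units.map (extensionEmbedding v).toMonoidHom cu) : ℂ) = ζ := by
    rw [Complex.coe_unitPart]
    have : ((Units.map (extensionEmbedding v).toMonoidHom cu : ℂˣ) : ℂ) = ζ := hc
    rw [this, hζ1]
    simp
  have key := congrArg (fun f : (InfiniteAdeleRing K)ˣ →* Circle => (f (singleUnits K v cu) : ℂ)) h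
  simp only [infinityTypeChar_singleUnits, Circle.coe_zpow, hval] at key
  apply hζd
  calc ζ ^ (e v - e' v) = ζ ^ e v / ζ ^ e' v := zpow_sub₀ hζ0 _ _
    _ = 1 := by rw [key, div_self (zpow_ne_zero _ hζ0)]

/-- Hence a unitary Hecke character has at most one ∞-type at each complex place. -/
theorem UnitaryHeckeCharacter.infinityType_unique_of_isComplex (ψ : UnitaryHeckeCharacter K)
    {e e' : InfinitePlace K → ℤ} (he : ψ.HasInfinityType K e) (he' : ψ.HasInfinityType K e')
    {v : InfinitePlace K} (hv : v.IsComplex) : e v = e' v := by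
  apply infinityTypeChar_injective_of_isComplex K _ hv
  rw [← (ψ.hasInfinityType_iff K e).mp he, ← (ψ.hasInfinityType_iff K e').mp he']

end NumberField

end
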